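import Summits.BirchSwinnertonDyer.BirchSwinnertonDyer.Theorems.ByReductionTypeAtTwoMultUpperHalfTowerCertAddv2
import Summits.BirchSwinnertonDyer.BirchSwinnertonDyer.Theorems.ByReductionTypeAtTwoMultUpperHalfTowerTorsionLocal
import Summits.BirchSwinnertonDyer.BirchSwinnertonDyer.Theorems.ByReductionTypeAtTwoMultTowerNS2TwoBit
import HarnessLib

/-!
# Route `ByReductionTypeAtTwo`, crux `MultUpperHalfAtTwo` (item stmt-BirchSwinnertonDyer-19922): the TWO-BIT TOWER-gap doors at a
# NON-SPLIT multiplicative `2` with the PRINT binder `hNS2` REPLACED by the kernel theorem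
# `MultTowerNS2.twoTorsion_localTowerKerPrimary_le_four_nonsplitTwo` (`#𝒦_{v,n}[2^∞][2] ≤ 4` at every non-split `2`, every layer)

HONEST FRAMING (cell `bsd-2adic`, run/shared/lean/pub/bsd-2adic/, seat `bsd-2adic-tower-1` GEN 10, HUMAN RULINGS D-0036 / D-0054 /
D-0074): research route; THEOREMS ONLY; nothing is booked; BSD is not proved by any of this. The cell's non-split two-bit tower doors
(`MultTowerCert.towerGapAtTwo_of_layerSelmer_cert_nonsplitTwo`, `MultTowerTorsion.…_nonsplitTwo_of_torsion/_of_goodPrime`,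
`MultTowerAddv.…_nonsplitTwo_addv/_addv2`) take the PRINT binder `hNS2 = Greenberg1999.sec3_natCard_localTowerKerPrimary_le_four_nonsplitMultiplicative_two`
(Greenberg LNM 1716 p. 93, `|ker(r_{v_n})| ∼ 2c_v ≤ 4`) and consume only its `2`-torsion projection `MultTowerCert.atTwo_le_four_of_nonsplit`.
That projection is now the tree theorem `MultTowerNS2.twoTorsion_localTowerKerPrimary_le_four_nonsplitTwo` (`…MultTowerNS2TwoBit.lean`, this seat:
«among five `2`-torsion coinvariant classes two coincide», GEN 9's count without the Tate-unit step), so each door is re-issued with the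
`hNS2` argument REMOVED (same remaining signature). WHAT IS STILL DISPLAYED, NOT PROVED: PRINT {`h33g`, `hM`, `hA`}; the layer counts
`hlow`/`hup`, the torsion data and the arithmetic `harith` (certificate legs). The named fact `hNS2` itself (the ORDER `≤ 4` of the whole
kernel) is NOT proved here — only the projection the doors use. References: R. Greenberg, LNM 1716 (1999) §3 pp. 85–93.
-/

set_option autoImplicit false
-- the Theorems namespace of this sub repeats the summit name by design (D-0017 nested layout: Summit.<S>.<Sub>)
set_option linter.dupNamespace false

noncomputable section

open scoped Classical

open NumberField IsDedekindDomain WeierstrassCurve Literature.NumberTheory.EllipticCurves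
  Literature.NumberTheory.EllipticCurves.Greenberg1999
  Summit.BirchSwinnertonDyer.Rank1Residual.X5 Summit.BirchSwinnertonDyer.Rank1Residual.X5.O1
  Summit.BirchSwinnertonDyer.Rank1Residual

namespace Summit.BirchSwinnertonDyer.BirchSwinnertonDyer.Theorems.MultTowerCert

variable (W : WeierstrassCurve ℚ) [W.IsElliptic] [W.IsGloballyMinimal]

/-- **`h2` at a NON-SPLIT multiplicative `2`, TWO bits, KERNEL: `C₂ = 4`** at every layer `n` for a globally minimal `W/ℚ` multiplicative
non-split at `2` — the kernel theorem `MultTowerNS2.twoTorsion_localTowerKerPrimary_le_four_nonsplitTwo` in the `h2`-shape of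
`towerGapAtTwo_of_layerSelmer_cert_atTwo` (= `atTwo_le_four_of_nonsplit` without `hNS2`). [cite: GreenbergLNM1716, §3, between Prop. 3.6 and Prop. 3.7 (PDF p. 93)] -/
theorem atTwo_le_four_of_nonsplit_kernel (hmult : W.HasMultiplicativeReductionAtPrime 2)
    (hns : ¬ W.HasSplitMultiplicativeReductionAtPrime 2) (n : ℕ) :
    ∀ κ : ZpExtension ℚ 2, κ.IsCyclotomic → ∀ v : HeightOneSpectrum (𝓞 ℚ), ((2 : ℕ) : 𝓞 ℚ) ∈ v.asIdeal →
      Finite {x : W.localTowerKerPrimary κ (v.adicCompletion ℚ) n // 2 • x = 0} ∧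
        Nat.card {x : W.localTowerKerPrimary κ (v.adicCompletion ℚ) n // 2 • x = 0} ≤ 4 :=
  fun _ hκ v hv ↦ MultTowerNS2.twoTorsion_localTowerKerPrimary_le_four_nonsplitTwo W hmult hns hκ v hv n

/-- **The TWO-BIT GAP certificate at a NON-SPLIT multiplicative `2`, `hNS2` replaced by the kernel** (odd torsion order): PRINT {`h33g`, `hM`, `hA`}
+ layer counts at `j ≤ j'` with the arithmetic `2^d · 4 · ∏_{ℓ ∈ P} C_ℓ^{2^{min(j', e_ℓ)}} < 2^{2^{j'} − 2^j + a}` ⟹ `O1.TowerGapAtTwo W`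
(= `towerGapAtTwo_of_layerSelmer_cert_nonsplitTwo` without `hNS2`).
[cite: GreenbergLNM1716, §3 Lemmas 3.3–3.5 (PDF pp. 86–90) and pp. 90–93] [cite: SilvermanAEC2009, VII.1 Prop. 1.3, VII.5.1] -/
theorem towerGapAtTwo_of_layerSelmer_cert_nonsplitTwo_kernel
    (h33g : lemma33_localTowerKerPrimary_eq_bot_of_good.{0})
    (hM : lemma33_localTowerKerPrimary_cyclic_of_multiplicative.{0})
    (hA : lemma33_natCard_localTowerKerPrimary_le_four_of_additive.{0})
    (hmult : W.HasMultiplicativeReductionAtPrime 2) (hns : ¬ W.HasSplitMultiplicativeReductionAtPrime 2)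
    (htors : ¬ 2 ∣ W.torsionOrder) {j j' a d : ℕ} (hjj' : j ≤ j')
    (P : Finset ℕ) (hP : ∀ ℓ ∈ P, ℓ.Prime ∧ ℓ ≠ 2)
    (hΔ : ∀ ℓ : ℕ, ℓ.Prime → ℓ ≠ 2 → (ℓ : ℤ) ∣ W.minimalDiscriminantInt → ℓ ∈ P)
    (C e k : ℕ → ℕ) (he : ∀ ℓ ∈ P, ¬ 2 ^ (e ℓ + 4) ∣ ℓ ^ 2 - 1)
    (hC : ∀ (ℓ : ℕ) [Fact ℓ.Prime], ℓ ∈ P →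
      4 ≤ C ℓ ∨ (W.HasMultiplicativeReductionAtPrime ℓ ∧ 2 ≤ C ℓ) ∨
        (W.HasMultiplicativeReductionAtPrime ℓ ∧ (ℓ : ℤ) ^ k ℓ ∣ W.minimalDiscriminantInt ∧
          ¬ (ℓ : ℤ) ^ (k ℓ + 1) ∣ W.minimalDiscriminantInt ∧ ¬ 2 ∣ k ℓ ∧ 1 ≤ C ℓ) ∨
        (¬ (ℓ : ℤ) ∣ W.minimalDiscriminantInt ∧ 1 ≤ C ℓ))
    (hlow : ∀ κ : ZpExtension ℚ 2, κ.IsCyclotomic →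
      2 ^ a ≤ Nat.card {z : W.selmerLayer κ j // 2 • z = 0})
    (hup : ∀ κ : ZpExtension ℚ 2, κ.IsCyclotomic →
      Nat.card {z : W.selmerLayer κ j' // 2 • z = 0} ≤ 2 ^ d)
    (harith : 2 ^ d * 4 * ∏ ℓ ∈ P, C ℓ ^ 2 ^ min j' (e ℓ) < 2 ^ (2 ^ j' - 2 ^ j + a)) :
    TowerGapAtTwo W :=
  towerGapAtTwo_of_layerSelmer_cert_atTwo W h33g hM hA htors hjj' 4 (atTwo_le_four_of_nonsplit_kernel W hmult hns j')
    P hP hΔ C e k he hC hlow hup harith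

end Summit.BirchSwinnertonDyer.BirchSwinnertonDyer.Theorems.MultTowerCert

namespace Summit.BirchSwinnertonDyer.BirchSwinnertonDyer.Theorems.MultTowerTorsion

variable (W : WeierstrassCurve ℚ) [W.IsElliptic] [W.IsGloballyMinimal]

/-- **The TWO-BIT GAP certificate at a NON-SPLIT multiplicative `2`, rational `2`-torsion allowed, `hNS2` replaced by the kernel** (any lower
layer `j`): = `towerGapAtTwo_of_layerSelmer_cert_nonsplitTwo_of_torsion` without `hNS2`; arithmetic
`2^{d+t} · 4 · ∏_{ℓ∈P} C_ℓ^{2^{min(j', e_ℓ)}} < 2^{2^{j'} − 2^j + a}`.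
[cite: GreenbergLNM1716, §3 pp. 85–94 (Lemmas 3.3–3.5; between Prop. 3.6 and 3.7, PDF p. 93)] [cite: SilvermanAEC2009, VII.1 Prop. 1.3, VII.5.1] -/
theorem towerGapAtTwo_of_layerSelmer_cert_nonsplitTwo_of_torsion_kernel
    (h33g : lemma33_localTowerKerPrimary_eq_bot_of_good.{0})
    (hM : lemma33_localTowerKerPrimary_cyclic_of_multiplicative.{0})
    (hA : lemma33_natCard_localTowerKerPrimary_le_four_of_additive.{0})
    (hmult : W.HasMultiplicativeReductionAtPrime 2) (hns : ¬ W.HasSplitMultiplicativeReductionAtPrime 2)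
    (hB : ∀ κ : ZpExtension ℚ 2, κ.IsCyclotomic →
      Finite (FixedPoints.addSubgroup κ.kerSubgroup (geomPrimaryTorsion W 2)))
    {j j' a d t : ℕ} (hjj' : j ≤ j')
    (htor : ∀ κ : ZpExtension ℚ 2, κ.IsCyclotomic →
      Nat.card {m : geomPrimaryTorsion W 2 | ∀ σ ∈ κ.layerSubgroup j, σ • m = m} ≤ 2 ^ t)
    (P : Finset ℕ) (hP : ∀ ℓ ∈ P, ℓ.Prime ∧ ℓ ≠ 2)
    (hΔ : ∀ ℓ : ℕ, ℓ.Prime → ℓ ≠ 2 → (ℓ : ℤ) ∣ W.minimalDiscriminantInt → ℓ ∈ P)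
    (C e k : ℕ → ℕ) (he : ∀ ℓ ∈ P, ¬ 2 ^ (e ℓ + 4) ∣ ℓ ^ 2 - 1)
    (hC : ∀ (ℓ : ℕ) [Fact ℓ.Prime], ℓ ∈ P →
      4 ≤ C ℓ ∨ (W.HasMultiplicativeReductionAtPrime ℓ ∧ 2 ≤ C ℓ) ∨
        (W.HasMultiplicativeReductionAtPrime ℓ ∧ (ℓ : ℤ) ^ k ℓ ∣ W.minimalDiscriminantInt ∧
          ¬ (ℓ : ℤ) ^ (k ℓ + 1) ∣ W.minimalDiscriminantInt ∧ ¬ 2 ∣ k ℓ ∧ 1 ≤ C ℓ) ∨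
        (¬ (ℓ : ℤ) ∣ W.minimalDiscriminantInt ∧ 1 ≤ C ℓ))
    (hlow : ∀ κ : ZpExtension ℚ 2, κ.IsCyclotomic →
      2 ^ a ≤ Nat.card {z : W.selmerLayer κ j // 2 • z = 0})
    (hup : ∀ κ : ZpExtension ℚ 2, κ.IsCyclotomic →
      Nat.card {z : W.selmerLayer κ j' // 2 • z = 0} ≤ 2 ^ d)
    (harith : 2 ^ (d + t) * 4 * ∏ ℓ ∈ P, C ℓ ^ 2 ^ min j' (e ℓ) < 2 ^ (2 ^ j' - 2 ^ j + a)) :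
    TowerGapAtTwo W :=
  towerGapAtTwo_of_layerSelmer_cert_atTwo_of_torsion W h33g hM hA hB hjj' htor 4
    (MultTowerCert.atTwo_le_four_of_nonsplit_kernel W hmult hns j') P hP hΔ C e k he hC hlow hup harith

/-- **The TWO-BIT GAP certificate at a NON-SPLIT multiplicative `2`, lower layer `ℚ`, `hNS2` replaced by the kernel, every remaining datum
PRINT or decidable**: = `towerGapAtTwo_of_layerSelmer_cert_nonsplitTwo_of_goodPrime` without `hNS2` (`hBtors` may be fed by name with the tree
theorem `Greenberg1999.finite_torsion_cyclotomicZpExtension_holds`); arithmetic `2^{d+t} · 4 · ∏_{ℓ∈P} C_ℓ^{2^{min(j', e_ℓ)}} < 2^{2^{j'} − 1 + a}`.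
[cite: GreenbergLNM1716, §1 p. 62, §3 pp. 85–94, §4 Lemma 4.3] [cite: SilvermanAEC2009, VII.3 Prop. 3.1(b), VII.5.1]
[cite: Ribet1981KatzLangAppendix, Theorem (p. 315)] -/
theorem towerGapAtTwo_of_layerSelmer_cert_nonsplitTwo_of_goodPrime_kernel
    (h33g : lemma33_localTowerKerPrimary_eq_bot_of_good.{0})
    (hM : lemma33_localTowerKerPrimary_cyclic_of_multiplicative.{0})
    (hA : lemma33_natCard_localTowerKerPrimary_le_four_of_additive.{0})
    (hmult : W.HasMultiplicativeReductionAtPrime 2) (hns : ¬ W.HasSplitMultiplicativeReductionAtPrime 2)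
    (hBtors : finite_torsion_cyclotomicZpExtension)
    (ℓ₀ : ℕ) [Fact ℓ₀.Prime] (h3 : 3 ≤ ℓ₀) (hgood : W.HasGoodReductionAtPrime ℓ₀) {t n : ℕ}
    (hn : W.reductionPointCount ℓ₀ = n) (hndvd : ¬ 2 ^ (t + 1) ∣ n) {j' a d : ℕ}
    (P : Finset ℕ) (hP : ∀ ℓ ∈ P, ℓ.Prime ∧ ℓ ≠ 2)
    (hΔ : ∀ ℓ : ℕ, ℓ.Prime → ℓ ≠ 2 → (ℓ : ℤ) ∣ W.minimalDiscriminantInt → ℓ ∈ P)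
    (C e k : ℕ → ℕ) (he : ∀ ℓ ∈ P, ¬ 2 ^ (e ℓ + 4) ∣ ℓ ^ 2 - 1)
    (hC : ∀ (ℓ : ℕ) [Fact ℓ.Prime], ℓ ∈ P →
      4 ≤ C ℓ ∨ (W.HasMultiplicativeReductionAtPrime ℓ ∧ 2 ≤ C ℓ) ∨
        (W.HasMultiplicativeReductionAtPrime ℓ ∧ (ℓ : ℤ) ^ k ℓ ∣ W.minimalDiscriminantInt ∧
          ¬ (ℓ : ℤ) ^ (k ℓ + 1) ∣ W.minimalDiscriminantInt ∧ ¬ 2 ∣ k ℓ ∧ 1 ≤ C ℓ) ∨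
        (¬ (ℓ : ℤ) ∣ W.minimalDiscriminantInt ∧ 1 ≤ C ℓ))
    (hlow : ∀ κ : ZpExtension ℚ 2, κ.IsCyclotomic →
      2 ^ a ≤ Nat.card {z : W.selmerLayer κ 0 // 2 • z = 0})
    (hup : ∀ κ : ZpExtension ℚ 2, κ.IsCyclotomic →
      Nat.card {z : W.selmerLayer κ j' // 2 • z = 0} ≤ 2 ^ d)
    (harith : 2 ^ (d + t) * 4 * ∏ ℓ ∈ P, C ℓ ^ 2 ^ min j' (e ℓ) < 2 ^ (2 ^ j' - 1 + a)) :
    TowerGapAtTwo W :=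
  towerGapAtTwo_of_layerSelmer_cert_nonsplitTwo_of_torsion_kernel W h33g hM hA hmult hns (fun κ hκ ↦ hBtors W 2 κ hκ)
    (Nat.zero_le j') (fun κ _ ↦ natCard_fixedBy_layerSubgroup_zero_le_of_goodPrime W ℓ₀ h3 hgood hn hndvd κ)
    P hP hΔ C e k he hC hlow hup (by rw [pow_zero]; exact harith)

end Summit.BirchSwinnertonDyer.BirchSwinnertonDyer.Theorems.MultTowerTorsion

namespace Summit.BirchSwinnertonDyer.BirchSwinnertonDyer.Theorems.MultTowerAddv

variable (W : WeierstrassCurve ℚ) [W.IsElliptic] [W.IsGloballyMinimal]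

/-- **The GAP certificate (FIVE disjuncts) at a NON-SPLIT multiplicative `2`, TWO bits, `hNS2` replaced by the kernel**: =
`towerGapAtTwo_of_layerSelmer_cert_nonsplitTwo_addv` without `hNS2`; arithmetic `2^d · 4 · ∏_{ℓ ∈ P} C_ℓ^{2^{min(j', e_ℓ)}} < 2^{2^{j'} − 2^j + a}`.
[cite: GreenbergLNM1716, §3 Lemmas 3.3–3.5 (PDF pp. 86–90) and pp. 90–93] [cite: SilvermanATAEC1994, IV.9 Table 4.1] -/
theorem towerGapAtTwo_of_layerSelmer_cert_nonsplitTwo_addv_kernel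
    (h33g : lemma33_localTowerKerPrimary_eq_bot_of_good.{0})
    (hM : lemma33_localTowerKerPrimary_cyclic_of_multiplicative.{0})
    (hA : lemma33_natCard_localTowerKerPrimary_le_four_of_additive.{0})
    (hmult : W.HasMultiplicativeReductionAtPrime 2) (hns : ¬ W.HasSplitMultiplicativeReductionAtPrime 2)
    (htors : ¬ 2 ∣ W.torsionOrder) {j j' a d : ℕ} (hjj' : j ≤ j')
    (P : Finset ℕ) (hP : ∀ ℓ ∈ P, ℓ.Prime ∧ ℓ ≠ 2)
    (hΔ : ∀ ℓ : ℕ, ℓ.Prime → ℓ ≠ 2 → (ℓ : ℤ) ∣ W.minimalDiscriminantInt → ℓ ∈ P)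
    (C e k : ℕ → ℕ) (he : ∀ ℓ ∈ P, ¬ 2 ^ (e ℓ + 4) ∣ ℓ ^ 2 - 1)
    (hC : ∀ (ℓ : ℕ) [Fact ℓ.Prime], ℓ ∈ P →
      4 ≤ C ℓ ∨ (W.HasMultiplicativeReductionAtPrime ℓ ∧ 2 ≤ C ℓ) ∨
        (W.HasMultiplicativeReductionAtPrime ℓ ∧ (ℓ : ℤ) ^ k ℓ ∣ W.minimalDiscriminantInt ∧
          ¬ (ℓ : ℤ) ^ (k ℓ + 1) ∣ W.minimalDiscriminantInt ∧ ¬ 2 ∣ k ℓ ∧ 1 ≤ C ℓ) ∨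
        (¬ (ℓ : ℤ) ∣ W.minimalDiscriminantInt ∧ 1 ≤ C ℓ) ∨
        ((ℓ : ℤ) ∣ (integralModelInt W).c₄ ∧ (ℓ : ℤ) ^ k ℓ ∣ W.minimalDiscriminantInt ∧
          ¬ (ℓ : ℤ) ^ (k ℓ + 1) ∣ W.minimalDiscriminantInt ∧
          (k ℓ = 2 ∨ k ℓ = 4 ∨ k ℓ = 5 ∨ (7 ≤ k ℓ ∧ k ℓ ≠ 9 ∧ (ℓ : ℤ) ^ k ℓ ∣ (integralModelInt W).c₄ ^ 3)) ∧ 1 ≤ C ℓ))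
    (hlow : ∀ κ : ZpExtension ℚ 2, κ.IsCyclotomic →
      2 ^ a ≤ Nat.card {z : W.selmerLayer κ j // 2 • z = 0})
    (hup : ∀ κ : ZpExtension ℚ 2, κ.IsCyclotomic →
      Nat.card {z : W.selmerLayer κ j' // 2 • z = 0} ≤ 2 ^ d)
    (harith : 2 ^ d * 4 * ∏ ℓ ∈ P, C ℓ ^ 2 ^ min j' (e ℓ) < 2 ^ (2 ^ j' - 2 ^ j + a)) :
    TowerGapAtTwo W :=
  towerGapAtTwo_of_layerSelmer_cert_atTwo_addv W h33g hM hA htors hjj' 4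
    (MultTowerCert.atTwo_le_four_of_nonsplit_kernel W hmult hns j') P hP hΔ C e k he hC hlow hup harith

/-- **The GAP certificate (SIX disjuncts) at a NON-SPLIT multiplicative `2`, TWO bits, `hNS2` replaced by the kernel**: =
`towerGapAtTwo_of_layerSelmer_cert_nonsplitTwo_addv2` without `hNS2`; arithmetic `2^d · 4 · ∏_{ℓ ∈ P} C_ℓ^{2^{min(j', e_ℓ)}} < 2^{2^{j'} − 2^j + a}`.
[cite: GreenbergLNM1716, §3 Lemmas 3.3–3.5 (PDF pp. 86–90) and pp. 90–93] [cite: SilvermanATAEC1994, IV.9 Table 4.1] -/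
theorem towerGapAtTwo_of_layerSelmer_cert_nonsplitTwo_addv2_kernel
    (h33g : lemma33_localTowerKerPrimary_eq_bot_of_good.{0})
    (hM : lemma33_localTowerKerPrimary_cyclic_of_multiplicative.{0})
    (hA : lemma33_natCard_localTowerKerPrimary_le_four_of_additive.{0})
    (hmult : W.HasMultiplicativeReductionAtPrime 2) (hns : ¬ W.HasSplitMultiplicativeReductionAtPrime 2)
    (htors : ¬ 2 ∣ W.torsionOrder) {j j' a d : ℕ} (hjj' : j ≤ j')
    (P : Finset ℕ) (hP : ∀ ℓ ∈ P, ℓ.Prime ∧ ℓ ≠ 2)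
    (hΔ : ∀ ℓ : ℕ, ℓ.Prime → ℓ ≠ 2 → (ℓ : ℤ) ∣ W.minimalDiscriminantInt → ℓ ∈ P)
    (C e k : ℕ → ℕ) (he : ∀ ℓ ∈ P, ¬ 2 ^ (e ℓ + 4) ∣ ℓ ^ 2 - 1)
    (hC : ∀ (ℓ : ℕ) [Fact ℓ.Prime], ℓ ∈ P →
      4 ≤ C ℓ ∨ (W.HasMultiplicativeReductionAtPrime ℓ ∧ 2 ≤ C ℓ) ∨
        (W.HasMultiplicativeReductionAtPrime ℓ ∧ (ℓ : ℤ) ^ k ℓ ∣ W.minimalDiscriminantInt ∧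
          ¬ (ℓ : ℤ) ^ (k ℓ + 1) ∣ W.minimalDiscriminantInt ∧ ¬ 2 ∣ k ℓ ∧ 1 ≤ C ℓ) ∨
        (¬ (ℓ : ℤ) ∣ W.minimalDiscriminantInt ∧ 1 ≤ C ℓ) ∨
        ((ℓ : ℤ) ∣ (integralModelInt W).c₄ ∧ (ℓ : ℤ) ^ k ℓ ∣ W.minimalDiscriminantInt ∧
          ¬ (ℓ : ℤ) ^ (k ℓ + 1) ∣ W.minimalDiscriminantInt ∧
          (k ℓ = 2 ∨ k ℓ = 4 ∨ k ℓ = 5 ∨ (7 ≤ k ℓ ∧ k ℓ ≠ 9 ∧ (ℓ : ℤ) ^ k ℓ ∣ (integralModelInt W).c₄ ^ 3)) ∧ 1 ≤ C ℓ) ∨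
        ((ℓ : ℤ) ∣ (integralModelInt W).c₄ ∧ (ℓ : ℤ) ^ k ℓ ∣ W.minimalDiscriminantInt ∧
          ¬ (ℓ : ℤ) ^ (k ℓ + 1) ∣ W.minimalDiscriminantInt ∧ 1 ≤ k ℓ ∧ k ℓ ≠ 6 ∧
          (ℓ : ℤ) ^ k ℓ ∣ (integralModelInt W).c₄ ^ 3 ∧ 2 ≤ C ℓ))
    (hlow : ∀ κ : ZpExtension ℚ 2, κ.IsCyclotomic →
      2 ^ a ≤ Nat.card {z : W.selmerLayer κ j // 2 • z = 0})
    (hup : ∀ κ : ZpExtension ℚ 2, κ.IsCyclotomic →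
      Nat.card {z : W.selmerLayer κ j' // 2 • z = 0} ≤ 2 ^ d)
    (harith : 2 ^ d * 4 * ∏ ℓ ∈ P, C ℓ ^ 2 ^ min j' (e ℓ) < 2 ^ (2 ^ j' - 2 ^ j + a)) :
    TowerGapAtTwo W :=
  towerGapAtTwo_of_layerSelmer_cert_atTwo_addv2 W h33g hM hA htors hjj' 4
    (MultTowerCert.atTwo_le_four_of_nonsplit_kernel W hmult hns j') P hP hΔ C e k he hC hlow hup harith

end Summit.BirchSwinnertonDyer.BirchSwinnertonDyer.Theorems.MultTowerAddv

end
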